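import Summits.BirchSwinnertonDyer.Rank1Residual.Supersingular.X6KuriharaOfferShape
import Literature.NumberTheory.EllipticCurves.LocalTorsionGoodReductionProofs
import HarnessLib

/-!
# X6 ∧ `r_an = 0` ∧ `p ≥ 5`: the Kurihara-number OFFER SHAPE re-threaded through the PROOF-COVERED twin of C.-H. Kim's
# structure theorem (`…_of_localTorsionTrivial`, binder `#E(ℚ_p)[p] = 1` DISCHARGED on X6: `a_p = 0` is never anomalous) —
# the FLAG-FREE twins of `X6.bsdp_of_kim_rankZero_of_kuriharaNumber_ne_zero` → `X6.bsdp_rankZero_of_certifiedL` →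
# `X6.bsdp_rankZero_of_certifiedL_of_LValueBall` → `X6RankZero.bsdp_of_ainvs_of_certifiedL_of_LValueBall`
# (cell `bsd-print-x6`, seat p4 gen 3; route `PrintX6`, residual `EisensteinHalfFiveLeRest` stmt-21116 — per-pair support, closes no item)

WHY. Every Kurihara-number road of the X6 rank-0 census (`Supersingular/X6KuriharaOffer*`, 106 Err cells and 5 of the 6 Rest cells of
leaf A6 at `p ≥ 5`) threads BY NAME the named fact `Kim2022_rankZero_padicValRat_sha_of_kuriharaNumber_ne_zero`, which carries the ARM-P
flag `K26-(6)-shallow@t>0` (level-one certificate covered by the printed proof only where `t = ord_p #E(ℚ_p)[p^∞] = 0`). Its PROOF-COVERED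
twin `Kim2022_rankZero_padicValRat_sha_of_kuriharaNumber_ne_zero_of_localTorsionTrivial` (one extra binder `#E(ℚ_p)[p] = 1`,
`KuriharaNumberKimShaLengthLocalTorsionTrivial.lean`) is unflagged, and the bridge
`Kim2022_rankZero_padicValRat_sha_of_kuriharaNumber_ne_zero_of_nonAnomalous` (`LocalTorsionGoodReductionProofs.lean`, PROVED) discharges
that binder from `good p` and `p ∤ a_p − 1`. On class X6 (`p ≥ 5` good supersingular) `a_p = 0` (`ClassX6.frobeniusTrace_eq_zero`), so
`p ∤ −1`: the flag is IDLE on the whole class, but no X6 consumer was threaded through the twin. This file supplies the four generic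
layers of the offer chain with the twin as the `hKim` binder; everything else (statements, proofs) is the landed layer VERBATIM
(x10b gens 10–13: `X6KuriharaRoute`, `KuriharaTwistRecordAssembly`, `KuriharaTwistRecordAssemblyLValues`, `X6KuriharaOfferShape`).
Consumers: `X6RestCellsKimLocalTorsionTrivial.lean` (the Rest cells 138594b1, 246697a1, 321518d1, 331554a1 @ 5, flag-free).

THEOREMS ONLY; no definition, no named fact, nothing booked; per pair, NOT a class theorem; beyond-print theorem: NO.
References: C.-H. Kim, Amer. J. Math. 148 (2026) = arXiv:2203.12159v4, Thm. 1.9 (1), (6), Cor. 1.6, Prop. 3.2 [Kim2022StructureSelmer];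
[GreenbergVatsal2000] §3 Rem. 3.4; [Mazur1978] Cor. 4.1; [Serre1972] Prop. 21; [MazurTateTeitelbaum1986Invent] §I.8;
[CremonaAlgorithms1997] §2.8; [Miller2011LMS] Def. 1.1; [SilvermanAEC2009] VII.3.1, VII.5.1.
-/

set_option autoImplicit false

noncomputable section

open scoped Classical MatrixGroups ModularForm

open CongruenceSubgroup WeierstrassCurve Literature.NumberTheory.EllipticCurves
  Literature.NumberTheory.EllipticCurves.ModularForms
  Literature.NumberTheory.EllipticCurves.Rank1Residual
  Literature.NumberTheory.EllipticCurves.Rank1Residual.Typed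
  Literature.NumberTheory.EllipticCurves.Rank1Residual.X11RankOneCertificates
  Summit.BirchSwinnertonDyer.BirchSwinnertonDyer.Rank1Residual.IntModel
  Summit.BirchSwinnertonDyer.BirchSwinnertonDyer.Rank1Residual.X11RankOne
  Summit.BirchSwinnertonDyer.Rank1Residual.X11b
  Summit.BirchSwinnertonDyer.Rank1Residual.Supersingular.KuriharaTwist

namespace Summit.BirchSwinnertonDyer.Rank1Residual.Supersingular

section Route

variable (W : WeierstrassCurve ℚ) [W.IsElliptic] [W.IsGloballyMinimal] (p : ℕ) [Fact p.Prime]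

/-- **X6 ∧ `r_an = 0` ∧ `p ≥ 5`: `BSD(E,p)` from ONE unit Kurihara number, through the PROOF-COVERED Kim twin** — the statement of
`X6.bsdp_of_kim_rankZero_of_kuriharaNumber_ne_zero` with `hKim` the flag-free twin
`Kim2022_rankZero_padicValRat_sha_of_kuriharaNumber_ne_zero_of_localTorsionTrivial`. Its local-torsion binder `#E(ℚ_p)[p] = 1` is
discharged by the PROVED bridge `…_of_nonAnomalous` from good reduction at `p` (`ClassX6`) and `p ∤ a_p − 1`, automatic since `a_p = 0`
(`ClassX6.frobeniusTrace_eq_zero`). The rest of the proof is `Typed.bsdp_of_kim_rankZero_of_kuriharaNumber_ne_zero` verbatim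
(GZK: rank `0`, `Ш` finite; Kim (6): `ord_p(L(E,1)/Ω) = ord_p #Ш(p)`; `p ∤ ∏c`, `p ∤ #tors` by `ClassX6.irr`; Miller's `BSD(E,p)` by
`bsdp_of_padicValRat_eq`). Per pair; NOT a class theorem. [cite: Kim2022StructureSelmer, Thm. 1.9 (6) (PDF p. 8), Cor. 1.6, Prop. 3.2 (PDF p. 15)]
[cite: GreenbergVatsal2000, §3, Remark 3.4] [cite: Serre1972, §5.4 Prop. 21 i)] [cite: Miller2011LMS, Def. 1.1] -/
theorem X6.bsdp_of_kimLT_rankZero_of_kuriharaNumber_ne_zero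
    (hKim : Kim2022_rankZero_padicValRat_sha_of_kuriharaNumber_ne_zero_of_localTorsionTrivial)
    (hϖ : realPeriodRat_eq_unit_mul_plusPeriod)
    (hGZK : rank_eq_analyticRank_of_analyticRank_le_one) (hmod : hasEntireLFunction_rat)
    (hp : 5 ≤ p) (hX : ClassX6 W p) (hr : W.analyticRank = 0) (htam : ¬ p ∣ W.tamagawaProduct)
    {N : ℕ} [NeZero N] (f : CuspForm (Gamma0 N) 2) (hf : IsNewformOf W f)
    (n : ℕ) [NeZero n] (hn : Kato.IsKolyvaginProduct W p 1 n)
    (hcyc : ∀ (ℓ : ℕ) [Fact ℓ.Prime], ℓ ∣ n →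
      Nat.card {P : ((WeierstrassCurve.integralModelInt W).map
          (Int.castRingHom (ZMod ℓ))).toAffine.Point // p • P = 0} ≤ p)
    (ψ : (ℓ : ℕ) → (ZMod ℓ)ˣ →* Multiplicative (ZMod (p ^ 1)))
    (hψ : ∀ ℓ ∈ n.primeFactors, Function.Surjective (ψ ℓ))
    (hδ : kuriharaNumber f (p ^ 1) n ψ ≠ 0) : BSDp W p := by
  have hp2 : p ≠ 2 := by omega
  have hirr : W.HasIrreducibleModPGaloisRep p := ClassX6.irr W p hp2 hX
  have htors : ¬ p ∣ W.torsionOrder := by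
    intro hdvd
    have h0 := padicValNat_torsionOrder_eq_zero_of_irreducible W p hirr
    have hpos : 0 < W.torsionOrder := W.torsionOrder_pos_holds
    have : 1 ≤ padicValNat p W.torsionOrder :=
      one_le_padicValNat_of_dvd hpos.ne' hdvd
    omega
  have hL : W.entireLFunction 1 ≠ 0 := (W.analyticRank_eq_zero_iff_holds (hmod W)).mp hr
  -- `p` is not anomalous on X6: `a_p = 0`, so `p ∤ a_p − 1 = −1`
  have hna : ¬ (p : ℤ) ∣ W.frobeniusTrace p - 1 := by
    rw [ClassX6.frobeniusTrace_eq_zero W p hp2 hX, zero_sub, dvd_neg]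
    intro h
    have h1 : p ∣ 1 := by exact_mod_cast h
    have := Nat.le_of_dvd one_pos h1
    omega
  -- GZK in rank 0 and Kim's clause (6) through the proof-covered twin
  obtain ⟨hmw, hfin⟩ := hGZK W (by rw [hr]; exact zero_le_one)
  have hmw0 : W.mordellWeilRank = 0 := by rw [hmw, hr]
  obtain ⟨q, hq, hval⟩ :=
    Kim2022_rankZero_padicValRat_sha_of_kuriharaNumber_ne_zero_of_nonAnomalous hKim W p hp hX.1.1 hna
      (ClassX6.surj W p hp2 hX) hL hfin f hf (hϖ W p hp hX.1.1 hirr f hf) n hn hcyc ψ hψ hδ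
  have hΩpos : 0 < W.realPeriodRat := by
    haveI : (W.baseChange ℝ).IsElliptic := by rw [baseChange]; infer_instance
    exact (W.baseChange ℝ).realPeriod_pos'
  have hΩ : (W.realPeriodRat : ℂ) ≠ 0 := by exact_mod_cast hΩpos.ne'
  rw [div_eq_iff hΩ] at hq
  have hq0 : q ≠ 0 := by
    rintro rfl
    apply hL
    rw [hq]; simp
  haveI : Finite W.sha := hfin
  have hsha : padicValNat p (Nat.card (AddCommGroup.primaryComponent W.sha p)) =
      padicValNat p W.shaOrder := by
    unfold WeierstrassCurve.shaOrder
    exact padicValNat_card_addPrimaryComponent p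
  have htam0 : padicValNat p W.tamagawaProduct = 0 := padicValNat.eq_zero_of_not_dvd htam
  have htors0 : padicValNat p W.torsionOrder = 0 := padicValNat.eq_zero_of_not_dvd htors
  refine bsdp_of_padicValRat_eq p hmw hfin q hq0 ?_ ?_
  · rw [WeierstrassCurve.leadingLCoeff, hr, iteratedDeriv_zero, Nat.factorial_zero, Nat.cast_one,
      div_one, W.regulator_eq_one_of_rank_zero hmw0, mul_one, hq]
    push_cast; ring
  · rw [hval, hsha, htam0, htors0]
    push_cast; ring

end Route

section Assembly

variable (W : WeierstrassCurve ℚ) [W.IsElliptic] [W.IsGloballyMinimal]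

/-- **X6 ∧ `r_an = 0` ∧ `p ≥ 5` ∧ `p ∤ ∏c`: `BSD(E,p)` from a LANDED twist record, flag-free twin** — the statement of
`X6.bsdp_rankZero_of_certifiedL` with `hKim` the proof-covered twin; proof verbatim over `X6.bsdp_of_kimLT_rankZero_of_kuriharaNumber_ne_zero`
(`r.kuriharaNumber_ne_zero_of_consistent_of_isNewformOf` supplies `δ̃_n ≢ 0`). Per pair; NOT a class theorem; nothing booked.
[cite: Kim2022StructureSelmer, Thm. 1.9 (6) (PDF p. 8), Cor. 1.6] -/
theorem X6.bsdp_rankZero_of_certifiedL_LT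
    (hKim : Kim2022_rankZero_padicValRat_sha_of_kuriharaNumber_ne_zero_of_localTorsionTrivial)
    (hϖ : realPeriodRat_eq_unit_mul_plusPeriod)
    (hGZK : rank_eq_analyticRank_of_analyticRank_le_one) (hmod : hasEntireLFunction_rat)
    {rs : List TwistRecord} (hrs : CertifiedL rs) {r : TwistRecord} (hr : r ∈ rs) [Fact r.p.Prime]
    (hνp : r.primes.length < r.p) [NeZero r.n] (hν : r.n.primeFactors.card = r.primes.length)
    (hp : 5 ≤ r.p) (hX : ClassX6 W r.p) (hr0 : W.analyticRank = 0) (htam : ¬ r.p ∣ W.tamagawaProduct)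
    {N : ℕ} [NeZero N] (f : CuspForm (Gamma0 N) 2) (hf : IsNewformOf W f)
    (hn : Kato.IsKolyvaginProduct W r.p 1 r.n)
    (hcyc : ∀ (ℓ : ℕ) [Fact ℓ.Prime], ℓ ∣ r.n →
      Nat.card {P : ((WeierstrassCurve.integralModelInt W).map
          (Int.castRingHom (ZMod ℓ))).toAffine.Point // r.p • P = 0} ≤ r.p)
    (ψ : (ℓ : ℕ) → (ZMod ℓ)ˣ →* Multiplicative (ZMod (r.p ^ 1)))
    (hψ : ∀ ℓ ∈ r.n.primeFactors, Function.Surjective (ψ ℓ))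
    (hbins : ∀ j < r.p, ((r.bins.getD j 0 : ℤ) : ℚ) = (r.den : ℚ) * (r.components : ℚ) *
      ∑ a ∈ (Finset.univ : Finset (ZMod r.n)ˣ).filter (fun a =>
        (∑ ℓ ∈ r.n.primeFactors.attach, Multiplicative.toAdd
          (ψ ℓ.1 (ZMod.unitsMap (Nat.dvd_of_mem_primeFactors ℓ.2) a))).val = j),
        ratPlusSymbol f ((((a : ZMod r.n).val : ℕ) : ℚ) / (r.n : ℚ))) :
    BSDp W r.p :=
  have hp2 : r.p ≠ 2 := by omega
  X6.bsdp_of_kimLT_rankZero_of_kuriharaNumber_ne_zero W r.p hKim hϖ hGZK hmod hp hX hr0 htam f hf r.n hn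
    hcyc ψ hψ
    (r.kuriharaNumber_ne_zero_of_consistent_of_isNewformOf (hrs.consistent_of_mem hr)
      (hrs.deltaModP_pos_of_mem hr) hνp hν hf hp2 (ClassX6.irr W r.p hp2 hX) hn ψ hbins)

/-- **X6 ∧ `r_an = 0` ∧ `p ≥ 5` ∧ `p ∤ ∏c`: `BSD(E,p)` from a LANDED twist record, its rounding certificate and an enclosure of the
TWISTED `L`-VALUE combination, flag-free twin** — the statement of `X6.bsdp_rankZero_of_certifiedL_of_LValueBall` with `hKim` the
proof-covered twin; proof verbatim (`TwistRecord.bins_eq_of_validHasse_of_LValueBall`). Per pair; NOT a class theorem; nothing booked.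
[cite: Kim2022StructureSelmer, Thm. 1.9 (6) (PDF p. 8), Cor. 1.6] [cite: MazurTateTeitelbaum1986Invent, §I.8 (8.6)]
[cite: CremonaAlgorithms1997, §2.8 (2.8.8) (PDF p. 26)] -/
theorem X6.bsdp_rankZero_of_certifiedL_of_LValueBall_LT
    (hKim : Kim2022_rankZero_padicValRat_sha_of_kuriharaNumber_ne_zero_of_localTorsionTrivial)
    (hϖ : realPeriodRat_eq_unit_mul_plusPeriod)
    (hGZK : rank_eq_analyticRank_of_analyticRank_le_one) (hmod : hasEntireLFunction_rat)
    {rs : List TwistRecord} (hrs : CertifiedL rs) {r : TwistRecord} (hr : r ∈ rs) [Fact r.p.Prime]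
    (hνp : r.primes.length < r.p) [NeZero r.n] (hν : r.n.primeFactors.card = r.primes.length)
    {cs : List RoundingCert} (hcs : RoundingCertifiedHasse cs) {c : RoundingCert} (hc : c ∈ cs)
    (hcp : c.p = r.p) (hcn : c.n = r.n) (hcden : c.den = r.den) (hcbins : c.bins = r.bins)
    (hD' : 0 < c.dstar)
    (hp : 5 ≤ r.p) (hX : ClassX6 W r.p) (hr0 : W.analyticRank = 0) (htam : ¬ r.p ∣ W.tamagawaProduct)
    {N : ℕ} [NeZero N] (f : CuspForm (Gamma0 N) 2) (hf : IsNewformOf W f) (hcop : Nat.Coprime r.n N)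
    (hn : Kato.IsKolyvaginProduct W r.p 1 r.n)
    (hcyc : ∀ (ℓ : ℕ) [Fact ℓ.Prime], ℓ ∣ r.n →
      Nat.card {P : ((WeierstrassCurve.integralModelInt W).map
          (Int.castRingHom (ZMod ℓ))).toAffine.Point // r.p • P = 0} ≤ r.p)
    (ψ : (ℓ : ℕ) → (ZMod ℓ)ˣ →* Multiplicative (ZMod (r.p ^ 1)))
    (hψ : ∀ ℓ ∈ r.n.primeFactors, Function.Surjective (ψ ℓ))
    (hballL : ∀ (L : ZMod (r.p ^ 1) → ℂ → ℂ), (∀ j, j ≠ 0 → Differentiable ℂ (L j)) →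
      (∀ j, j ≠ 0 → ∀ s : ℂ, 2 < s.re → L j s = twistedLSeries f (binChar r.n ψ j)⁻¹ s) →
      ∀ k < r.p, ∃ mid rad : ℝ, rad ≤ (c.radNum : ℝ) / 10 ^ c.radExp ∧
        |mid - ((c.binsStar.getD k 0 : ℤ) : ℝ)| ≤ (c.marNum : ℝ) / 10 ^ c.marExp ∧
        |(c.dstar : ℝ) * ((r.components : ℝ) *
          (((∏ ℓ ∈ r.n.primeFactors, ((W.frobeniusTrace ℓ : ℂ) - 2)) * W.entireLFunction 1 +
            ∑ j ∈ (Finset.univ : Finset (ZMod (r.p ^ 1))).erase 0,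
              ZMod.stdAddChar (-(j * (k : ZMod (r.p ^ 1)))) *
                (gaussSum (binChar r.n ψ j) (ZMod.stdAddChar (N := r.n)) * L j 1)).re /
            ((r.p ^ 1 : ℕ) * plusPeriod f))) - mid| ≤ rad) :
    BSDp W r.p :=
  X6.bsdp_rankZero_of_certifiedL_LT W hKim hϖ hGZK hmod hrs hr hνp hν hp hX hr0 htam f hf hn hcyc ψ hψ
    (r.bins_eq_of_validHasse_of_LValueBall (hcs.validHasse_of_mem hc) hcp hcn hcden hcbins hD' hf hX.1.1 hcop
      (by omega) hn.squarefree (KuriharaTwist.hasGoodReductionAtPrime_of_isKolyvaginProduct hn) ψ hψ hballL)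

end Assembly

/-- **N4 RECORD SHAPE — `BSD(E,p)` on X6 ∧ `r_an = 0` ∧ `p ≥ 5` ∧ `p ∤ ∏c` from the literal equation, a landed twist record + rounding
certificate, kernel certificates, and the `L`-value enclosure, flag-free twin** — the statement of
`X6RankZero.bsdp_of_ainvs_of_certifiedL_of_LValueBall` (`X6KuriharaOfferShape.lean`) with `hKim` the proof-covered twin
`Kim2022_rankZero_padicValRat_sha_of_kuriharaNumber_ne_zero_of_localTorsionTrivial`; proof verbatim, ending in
`X6.bsdp_rankZero_of_certifiedL_of_LValueBall_LT`. REMAINING HYPOTHESES = EXACTLY the named facts `hKim` (twin, unflagged), `hϖ`, `hGZK`,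
`hmod`; the newform `f` (`hf`); the data binders `r_an = 0`, `p ∤ ∏c`; and `hballL`. Per pair; NOT a class theorem; nothing booked.
[cite: Kim2022StructureSelmer, Thm. 1.9 (6) (PDF p. 8), Cor. 1.6] [cite: MazurTateTeitelbaum1986Invent, §I.8 (8.6)]
[cite: CremonaAlgorithms1997, §2.8 (2.8.8) (PDF p. 26)] [cite: SilvermanAEC2009, VII.5 Prop. 5.1(a) and (b)]
[cite: IrelandRosen1990, Prop. 5.1.2 and §8.1] -/
theorem X6RankZero.bsdp_of_ainvs_of_certifiedL_of_LValueBall_LT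
    (hKim : Kim2022_rankZero_padicValRat_sha_of_kuriharaNumber_ne_zero_of_localTorsionTrivial)
    (hϖ : realPeriodRat_eq_unit_mul_plusPeriod)
    (hGZK : rank_eq_analyticRank_of_analyticRank_le_one) (hmod : hasEntireLFunction_rat)
    (a1 a2 a3 a4 a6 : ℤ)
    (hB : (discOf [a1, a2, a3, a4, a6]).natAbs < 512 ^ 12)
    (hmin : ∀ q < 512, q < 2 ∨ ¬ q ^ 12 ∣ (discOf [a1, a2, a3, a4, a6]).natAbs ∨
      ¬ q ^ 4 ∣ (c4Of [a1, a2, a3, a4, a6]).natAbs ∨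
      (q = 2 ∧ ¬ (2 : ℤ) ^ 8 ∣ c4Of [a1, a2, a3, a4, a6] ∧ (2 : ℤ) ^ 7 ∣ c6Of [a1, a2, a3, a4, a6]) ∨
      (q = 2 ∧ ¬ (2 : ℤ) ^ 24 ∣ discOf [a1, a2, a3, a4, a6] ∧ (512 : ℤ) ∣ c6Of [a1, a2, a3, a4, a6] ∧
        (4 : ℤ) ∣ c6Of [a1, a2, a3, a4, a6] / 512 - 3) ∨
      (q = 3 ∧ (3 : ℤ) ^ 8 ∣ c6Of [a1, a2, a3, a4, a6] ∧ ¬ (3 : ℤ) ^ 9 ∣ c6Of [a1, a2, a3, a4, a6]))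
    -- the landed twist record and its rounding certificate
    {rs : List TwistRecord} (hrs : CertifiedL rs) {r : TwistRecord} (hr : r ∈ rs) [Fact r.p.Prime] [NeZero r.n]
    (hνp : r.primes.length < r.p) (hν : r.n.primeFactors.card = r.primes.length)
    {c : RoundingCert} (hcv : c.validHasse = true)
    (hcp : c.p = r.p) (hcn : c.n = r.n) (hcden : c.den = r.den) (hcbins : c.bins = r.bins) (hD' : 0 < c.dstar)
    (hp : 5 ≤ r.p)
    -- class X6 at `p` from the model
    (hpΔ : ¬ (r.p : ℤ) ∣ discOf [a1, a2, a3, a4, a6]) {np : ℕ}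
    (hcnt : countPoints [a1, a2, a3, a4, a6] r.p = np) (hap : (r.p : ℤ) ∣ (r.p : ℤ) + 1 - np)
    (hgcd : Int.gcd (discOf [a1, a2, a3, a4, a6]) (c4Of [a1, a2, a3, a4, a6]) = 1)
    -- the Kolyvagin level `r.n = ℓ₁ · ℓ₂` from point counts
    (ℓ₁ ℓ₂ : ℕ) [Fact ℓ₁.Prime] [Fact ℓ₂.Prime] (hrn : r.n = ℓ₁ * ℓ₂) (hne : ℓ₁ ≠ ℓ₂)
    (hℓ₁p : ℓ₁ ≠ r.p) (hℓ₂p : ℓ₂ ≠ r.p) (hℓ₁2 : ℓ₁ ≠ 2) (hℓ₂2 : ℓ₂ ≠ 2)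
    (hℓ₁Δ : ¬ (ℓ₁ : ℤ) ∣ discOf [a1, a2, a3, a4, a6]) (hℓ₂Δ : ¬ (ℓ₂ : ℤ) ∣ discOf [a1, a2, a3, a4, a6])
    (h1₁ : ℓ₁ ≡ 1 [MOD r.p ^ 1]) (h1₂ : ℓ₂ ≡ 1 [MOD r.p ^ 1]) {n₁ n₂ : ℕ}
    (hc₁ : countPoints [a1, a2, a3, a4, a6] ℓ₁ = n₁) (hc₂ : countPoints [a1, a2, a3, a4, a6] ℓ₂ = n₂)
    (hd₁ : r.p ^ 1 ∣ n₁) (hd₂ : r.p ^ 1 ∣ n₂) (hsq₁ : ¬ r.p ^ 2 ∣ n₁) (hsq₂ : ¬ r.p ^ 2 ∣ n₂)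
    {A : ℤ} (hA : A = ((ℓ₁ : ℤ) + 1 - n₁ - 2) * ((ℓ₂ : ℤ) + 1 - n₂ - 2))
    -- the discrete logarithms
    (ψ₁ : (ZMod ℓ₁)ˣ →* Multiplicative (ZMod (r.p ^ 1))) (hψ₁ : Function.Surjective ψ₁)
    (ψ₂ : (ZMod ℓ₂)ˣ →* Multiplicative (ZMod (r.p ^ 1))) (hψ₂ : Function.Surjective ψ₂)
    -- data binders
    (hr0 : (⟨a1, a2, a3, a4, a6⟩ : WeierstrassCurve ℚ).analyticRank = 0)
    (htam : ¬ r.p ∣ (⟨a1, a2, a3, a4, a6⟩ : WeierstrassCurve ℚ).tamagawaProduct)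
    {N : ℕ} [NeZero N] (f : CuspForm (Gamma0 N) 2) (hf : IsNewformOf (⟨a1, a2, a3, a4, a6⟩ : WeierstrassCurve ℚ) f)
    -- the engine's enclosure claim, through twisted L-values
    (hballL : ∀ (L : ZMod (r.p ^ 1) → ℂ → ℂ), (∀ j, j ≠ 0 → Differentiable ℂ (L j)) →
      (∀ j, j ≠ 0 → ∀ s : ℂ, 2 < s.re →
        L j s = twistedLSeries f (binChar r.n (pairLogs ℓ₁ ℓ₂ ψ₁ ψ₂) j)⁻¹ s) →
      ∀ k < r.p, ∃ mid rad : ℝ, rad ≤ (c.radNum : ℝ) / 10 ^ c.radExp ∧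
        |mid - ((c.binsStar.getD k 0 : ℤ) : ℝ)| ≤ (c.marNum : ℝ) / 10 ^ c.marExp ∧
        |(c.dstar : ℝ) * ((r.components : ℝ) *
          (((A : ℂ) * (⟨a1, a2, a3, a4, a6⟩ : WeierstrassCurve ℚ).entireLFunction 1 +
            ∑ j ∈ (Finset.univ : Finset (ZMod (r.p ^ 1))).erase 0,
              ZMod.stdAddChar (-(j * (k : ZMod (r.p ^ 1)))) *
                (gaussSum (binChar r.n (pairLogs ℓ₁ ℓ₂ ψ₁ ψ₂) j) (ZMod.stdAddChar (N := r.n)) * L j 1)).re /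
            ((r.p ^ 1 : ℕ) * plusPeriod f))) - mid| ≤ rad) :
    BSDp (⟨a1, a2, a3, a4, a6⟩ : WeierstrassCurve ℚ) r.p := by
  have h0 : discOf [a1, a2, a3, a4, a6] ≠ 0 := fun h ↦ hpΔ (by rw [h]; exact dvd_zero _)
  obtain ⟨_, _, hI⟩ := integralModelInt_ainvs_of_krausCriterion_bounded a1 a2 a3 a4 a6 h0 hB hmin
  have hp2 : r.p ≠ 2 := by omega
  have hN₁ := natCard_point_eq_of_countPoints a1 a2 a3 a4 a6 ℓ₁ hℓ₁2 hℓ₁Δ hc₁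
  have hN₂ := natCard_point_eq_of_countPoints a1 a2 a3 a4 a6 ℓ₂ hℓ₂2 hℓ₂Δ hc₂
  -- class X6 at `p`
  have hX : ClassX6 (⟨a1, a2, a3, a4, a6⟩ : WeierstrassCurve ℚ) r.p :=
    classX6_of_intModel r.p hp hI (by rw [intCurve_Δ]; exact hpΔ)
      (natCard_point_eq_of_countPoints a1 a2 a3 a4 a6 r.p hp2 hpΔ hcnt) hap
      (by rw [intCurve_Δ, intCurve_c₄]; exact hgcd)
  -- the Kolyvagin level and cyclicity from the two point counts
  have hK₁ : Kato.IsKolyvaginPrime (⟨a1, a2, a3, a4, a6⟩ : WeierstrassCurve ℚ) r.p 1 ℓ₁ :=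
    Additive.isKolyvaginPrime_of_intModel_of_card hI r.p 1 ℓ₁ hℓ₁p (by rw [intCurve_Δ]; exact hℓ₁Δ) h1₁ hN₁ hd₁
  have hK₂ : Kato.IsKolyvaginPrime (⟨a1, a2, a3, a4, a6⟩ : WeierstrassCurve ℚ) r.p 1 ℓ₂ :=
    Additive.isKolyvaginPrime_of_intModel_of_card hI r.p 1 ℓ₂ hℓ₂p (by rw [intCurve_Δ]; exact hℓ₂Δ) h1₂ hN₂ hd₂
  have hn : Kato.IsKolyvaginProduct (⟨a1, a2, a3, a4, a6⟩ : WeierstrassCurve ℚ) r.p 1 r.n := by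
    rw [hrn]; exact Additive.isKolyvaginProduct_mul hK₁ hK₂ hne
  have hcyc : ∀ (ℓ : ℕ) [Fact ℓ.Prime], ℓ ∣ r.n →
      Nat.card {P : ((WeierstrassCurve.integralModelInt (⟨a1, a2, a3, a4, a6⟩ : WeierstrassCurve ℚ)).map
          (Int.castRingHom (ZMod ℓ))).toAffine.Point // r.p • P = 0} ≤ r.p := by
    rw [hrn]
    exact Additive.forall_card_torsion_le_of_pair hI r.p ℓ₁ ℓ₂ hN₁ hN₂ hsq₁ hsq₂
  -- the discrete logarithms
  have hψ : ∀ ℓ ∈ r.n.primeFactors, Function.Surjective (pairLogs ℓ₁ ℓ₂ ψ₁ ψ₂ ℓ) := by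
    rw [hrn]
    exact surjective_pairLogs_of_mem_primeFactors ψ₁ ψ₂ Fact.out Fact.out hne hψ₁ hψ₂
  -- the certificate row as a one-element `RoundingCertifiedHasse` list
  have hcs : RoundingCertifiedHasse [c] :=
    (RoundingCertifiedHasse.cons_iff c []).2 ⟨hcv, RoundingCertifiedHasse.nil⟩
  -- `A = Π_{ℓ ∣ n} (a_ℓ − 2)`
  have hprod : (∏ ℓ ∈ r.n.primeFactors,
      (((⟨a1, a2, a3, a4, a6⟩ : WeierstrassCurve ℚ).frobeniusTrace ℓ : ℂ) - 2)) = (A : ℂ) := by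
    rw [hrn]; exact prod_primeFactors_frobeniusTrace_sub_two_eq hI Fact.out Fact.out hne hN₁ hN₂ hA
  refine X6.bsdp_rankZero_of_certifiedL_of_LValueBall_LT _ hKim hϖ hGZK hmod hrs hr hνp hν hcs
    (List.mem_singleton_self c) hcp hcn hcden hcbins hD' hp hX hr0 htam f hf
    (coprime_level_of_isKolyvaginProduct hf hn) hn hcyc (pairLogs ℓ₁ ℓ₂ ψ₁ ψ₂) hψ ?_
  intro L hL hL' k hk
  obtain ⟨mid, rad, h1, h2, h3⟩ := hballL L hL hL' k hk
  refine ⟨mid, rad, h1, h2, ?_⟩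
  rw [hprod]
  exact h3

end Summit.BirchSwinnertonDyer.Rank1Residual.Supersingular

end
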